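import Summits.HubbardSuperconductivity.HubbardSuperconductivity.Theorems.KacWindowPenaltyWindowGapPenalisedForms
import HarnessLib

/-!
# Route `KacWindowPenalty` — crux `WindowGap` (stmt-HubbardSuperconductivity-1088),
# line `sector-invisible-dressing`: the window dominates the order field (`stub_windowDominates`)

Helper (`--supports stmt-HubbardSuperconductivity-1088`) for the crux
`Summit.HubbardSuperconductivity.HubbardSuperconductivity.Theses.KacWindowPenalty.WindowGap`,
line `sector-invisible-dressing`, stub `stub_windowDominates` (hypothesis `hWA` of the line's
abstract bridge `dressedBridge`).

**Statement.** For the Kac window `W_ε = L⁻² Σ_{|q_m| ≤ ε} Δ_d(m)ᴴ Δ_d(m)`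
(`Δ_d(m) = pairFieldAt dWaveFormFactor L m`, `Δ_d(0) = Δ_d = pairField dWaveFormFactor L`) and a
unit Fock vector `φ`: `(Re ⟨φ, Δ_d φ⟩)² / L² ≤ Re ⟨φ, W_ε φ⟩`.

**Proof.** Cauchy–Schwarz for the `dotProduct` pairing,
`(Re ⟨φ, Δ_d φ⟩)² ≤ |⟨φ, Δ_d φ⟩|² ≤ ⟨φ, φ⟩ · ‖Δ_d φ‖² = Re ⟨φ, Δ_dᴴ Δ_d φ⟩`
(`norm_star_dotProduct_sq_le_re_mul_re`, adapted from the tree's `norm_star_dotProduct_sq_le` in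
`Literature/MathematicalPhysics/QuantumLattice/FreeFermiGasPairGramBounds.lean`, which is not on
this import path), divided by `L²`, and then the window dominates its zero mode
(`re_expect_pairField_div_le_re_dotProduct_kacWindow_mulVec`: the label `m = 0` is always in the
window and the other structure factors are nonnegative).

No definition introduced, folklore; C. N. Yang, Rev. Mod. Phys. 34 (1962) 694, §3
(Cauchy–Schwarz bounds on pair correlations); Scalapino, Phys. Rep. 250 (1995) 329, §2.

## Mathlib / tree search

Tree: `star_dotProduct_eq_inner`, `norm_toLp_sq_eq_re`, `star_mulVec_dotProduct_mulVec`
(PairFieldMomentum), `re_expect_pairField_div_le_re_dotProduct_kacWindow_mulVec`.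
Mathlib: `norm_inner_le_norm`, `Complex.abs_re_le_norm`, `div_le_div_of_nonneg_right`.
-/

noncomputable section

-- the mandated namespace `Summit.<Summit>.<Problem>.Theorems` repeats `HubbardSuperconductivity`
-- (single-problem summit, D-0017), which the `dupNamespace` linter flags on every declaration
set_option linter.dupNamespace false

namespace Summit.HubbardSuperconductivity.HubbardSuperconductivity.Theorems

open Matrix Literature.MathematicalPhysics.QuantumLattice

/-- **Cauchy–Schwarz** for the `dotProduct` pairing on `n → ℂ`, squared:
`‖a⋆ · b‖² ≤ Re (a⋆ · a) · Re (b⋆ · b)` (the pairing is the Euclidean inner product of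
`EuclideanSpace ℂ n`, `star_dotProduct_eq_inner`, and `‖·‖₂² = Re (a⋆ · a)`, `norm_toLp_sq_eq_re`).
Adapted from `norm_star_dotProduct_sq_le` (FreeFermiGasPairGramBounds). [folklore] -/
theorem norm_star_dotProduct_sq_le_re_mul_re {n : Type*} [Fintype n] (a b : n → ℂ) :
    ‖star a ⬝ᵥ b‖ ^ 2 ≤ (star a ⬝ᵥ a).re * (star b ⬝ᵥ b).re := by
  -- adapted from Literature/MathematicalPhysics/QuantumLattice/FreeFermiGasPairGramBounds.lean
  rw [star_dotProduct_eq_inner, ← norm_toLp_sq_eq_re, ← norm_toLp_sq_eq_re, ← mul_pow]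
  exact pow_le_pow_left₀ (norm_nonneg _) (norm_inner_le_norm _ _) 2

/-- **The order field is dominated by its square** (Cauchy–Schwarz at a unit vector): for a
matrix `A` and `φ` with `⟨φ, φ⟩ = 1`, `(Re ⟨φ, A φ⟩)² ≤ Re ⟨φ, Aᴴ A φ⟩ = ‖A φ‖²`.
C. N. Yang, Rev. Mod. Phys. 34 (1962) 694, §3. [folklore] -/
theorem re_dotProduct_mulVec_sq_le_re_expect_conjTranspose_mul {n : Type*} [Fintype n]
    (A : Matrix n n ℂ) (φ : n → ℂ) (hφ : star φ ⬝ᵥ φ = 1) :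
    (star φ ⬝ᵥ A *ᵥ φ).re ^ 2 ≤ (star φ ⬝ᵥ (Aᴴ * A) *ᵥ φ).re := by
  have hcs := norm_star_dotProduct_sq_le_re_mul_re φ (A *ᵥ φ)
  rw [hφ, Complex.one_re, one_mul, star_mulVec_dotProduct_mulVec] at hcs
  have hre : (star φ ⬝ᵥ A *ᵥ φ).re ^ 2 ≤ ‖star φ ⬝ᵥ A *ᵥ φ‖ ^ 2 := by
    rw [← sq_abs]
    exact pow_le_pow_left₀ (abs_nonneg _) (Complex.abs_re_le_norm _) 2
  exact hre.trans hcs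

/-- **Stub `stub_windowDominates`** of line `sector-invisible-dressing` (crux `WindowGap`,
stmt-HubbardSuperconductivity-1088). For the Kac window
`W_ε = L⁻² Σ_{|q_m| ≤ ε} Δ_d(m)ᴴ Δ_d(m)` (`Δ_d(m) = pairFieldAt dWaveFormFactor L m`) and a unit
Fock vector `φ`, `(Re ⟨φ, Δ_d φ⟩)² / L² ≤ Re ⟨φ, W_ε φ⟩`: Cauchy–Schwarz
`(Re ⟨φ, Δ_d φ⟩)² ≤ |⟨φ, Δ_d φ⟩|² ≤ ‖Δ_d φ‖² = Re ⟨φ, Δ_dᴴ Δ_d φ⟩`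
(`re_dotProduct_mulVec_sq_le_re_expect_conjTranspose_mul`), divided by `L²`, and the window
dominates its zero mode `Δ_d(0) = Δ_d`
(`re_expect_pairField_div_le_re_dotProduct_kacWindow_mulVec`). C. N. Yang, Rev. Mod. Phys. 34
(1962) 694, §3; Scalapino, Phys. Rep. 250 (1995) 329, §2. [folklore] -/
theorem stub_windowDominates (L : ℕ) [NeZero L] (ε : ℝ) (φ : Fock (Orb (FermionTorus 2 L)))
    (hφ : star φ ⬝ᵥ φ = 1) :
    (star φ ⬝ᵥ pairField dWaveFormFactor L *ᵥ φ).re ^ 2 / (L : ℝ) ^ 2 ≤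
      (star φ ⬝ᵥ (∑ m : Fin 2 → ZMod L,
        if (2 * Real.pi / (L : ℝ)) ^ 2 * (∑ i : Fin 2, (((m i).valMinAbs : ℤ) : ℝ) ^ 2) ≤ ε ^ 2 then
          ((L : ℂ) ^ 2)⁻¹ • (Matrix.conjTranspose (pairFieldAt dWaveFormFactor L m) *
            pairFieldAt dWaveFormFactor L m)
        else 0) *ᵥ φ).re := by
  have hsq := re_dotProduct_mulVec_sq_le_re_expect_conjTranspose_mul
    (pairField dWaveFormFactor L) φ hφ
  exact (div_le_div_of_nonneg_right hsq (sq_nonneg _)).trans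
    (re_expect_pairField_div_le_re_dotProduct_kacWindow_mulVec L ε φ)

end Summit.HubbardSuperconductivity.HubbardSuperconductivity.Theorems
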